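import Literature.MathematicalPhysics.QuantumFieldTheory.Balaban1983to89.B8TowerBondsLayerLawSubC
import Literature.MathematicalPhysics.QuantumFieldTheory.Balaban1983to89.B8IdxB8LamTopTowerDisjoint

/-!
# `Balaban1983to89.B8IdxB8LamTopOfTowerDisjoint` — [Balaban1985RegularSpaces] (1.5)–(1.6) p. 77: ON A LAWFUL ADMISSIBLE MEMBER, TOP-TOWER DISJOINTNESS
# («Ω_j^{(j)} = ⋃_{l ≥ j} B^{l−j}(Λ_l)» as a PARTITION) IMPLIES THE (1.5)-READING `LamTop` — the converse of dag-n05-c's `LamTop ⇒ towers disjoint`, so the two repair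
# letters proposed for the «P₂C» binders are EQUIVALENT on the index of record

statement-level skeleton of published theorems with citation tags; proofs where landed; nothing here is a claim about the Yang–Mills mass gap

T. Bałaban, *Spaces of regular gauge field configurations on a lattice and gauge fixing conditions*, Commun. Math. Phys. **99** (1985) 75–102
`[Balaban1985RegularSpaces]` ("B8"; journal page = PDF page + 74): (1.3)–(1.6) p. 77 («Ω_j = Bʲ(Ω_j^{(j)})», «Λ_j = Ω_j^{(j)} ∖ Ω_{j+1}^{(j)}», «Ω_j^{(j)} = ⋃_{l≥j} B^{l−j}(Λ_l)»,
«Ω = ⋃_j Bʲ(Λ_j)»), (1.131) p. 99, p. 98.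

## WHY THIS FILE (cell `pub-ymgap`, HUMAN RULING D-0062 ∕ D-0149; DAG node N05 = [B8]; width seat `pub-ymgap-dag-n05-w2` g3; proof lane, count-neutral)

Two census exhibits (dag-n05-w1 `B8SockLettersRDIdxB8LawsBVacuity` p613168 — the all-`univ` member `i⋆`; this seat's `B8IdxB8SubCLayerLawVacuity` p613383 — the extra-tops member)
show that the «P₂C» binders' member class `Ω₀ = ℤᵈ ∧ IdxB8LawsB ∧ DomainSeq` is too wide for letters reading tower geometry, and two REPAIR LETTERS are on the table (cell bus
2026-08-28 07:07–07:45Z): print's (1.5) corner reading `LamTop` («`∀ j < k, ∀ z ∈ Λs k j, Lʲ•z ∈ Lam L Ω j`», this lineage's `hΛ`; dag-n05-c's DESIGN WORD picks it as the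
primitive) and TOP-TOWER DISJOINTNESS («the blocks `Bʲ(z)`, `j ≤ k`, `z ∈ Λs k j`, are pairwise disjoint» — dag-n05-c g5's `TowerDisjoint` on the Landau carrier; the CONSEQUENCE
the letter `H′` needs; dag-n05-c's `B8IdxB8LamTopTowerDisjoint` (p613464) derives it FROM `LamTop`).  THIS FILE proves the CONVERSE: on a member obeying NODE 00's located laws
(only №11 `cover` is used) whose Ω-tower is a (1.3)–(1.4) domain sequence (only `sat` is used) — i.e. on every member of `IdxB8SubC θ` — top-tower disjointness IMPLIES
`LamTop`.  MECHANISM: the corner `c = Lʲ•z` of a top `z ∈ Λs k j` (`j < k`) is a level-`j` point of `Ω_j` (`ZdIdx.htower` at the corner); were `c ∈ Ω_{j+1}`, the whole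
`(j+1)`-block of `w := ⌊c ∕ L^{j+1}⌋` would lie in `Ω_{j+1}` (`sat`), so `cover` at `ℓ = j+1` puts `w` under a top `y ∈ Λs k j′` with `j′ ≥ j+1`, whence `c` lies under `y` at
scale `j′` AND under `z` at scale `j` — disjointness forces `j = j′`, absurd.  Hence the two letters are EQUIVALENT on lawful admissible members (with dag-n05-c's forward
direction), and either may be conjoined to the binders ∕ cut as `IdxB8SubD` without loss; this seat's `exists_idxB8SubC_topCube_pinned` (p611723) inhabits both at every depth.

## WHAT IS PROVED (kernel, 0 sorry; theorems only)

* §1 ★★ `lamTop_of_towersDisjoint` (`L ≥ 1`, `i : ZdIdx d L`, `IdxB8Laws L i`, `DomainSeq L i.Ω`, top-tower disjointness in dag-n05-c's text ⇒ `LamTop`),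
  ★ `IdxB8SubC.lamTop_of_towersDisjoint` (the same on the admissible sub-index of record, laws by name), `IdxB8SubC.levelSepPP_towerBondsP_of_towersDisjoint` (hence the
  P-class law at every truncation, through p611723's face),
  ★★ `lamTop_iff_towersDisjoint_top` ∕ ★ `IdxB8SubC.lamTop_iff_towersDisjoint_top` (THE EQUIVALENCE, with dag-n05-c's forward direction p613464 by name).
* §2 A6 at every depth: `exists_idxB8SubC_towersDisjoint` — print's pinned tower `(ℤᵈ, □₁, …, □_k)` (p611723, a term of `IdxB8SubC θ` reading (1.5)) has pairwise disjoint top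
  towers (reading ∘ forward direction), every `θ`, every `k ≥ 1`.

## HONEST SCOPE

Lattice bookkeeping on `ℤᵈ`; NO estimate of [Balaban1985RegularSpaces] ∕ [4]; both letters stay DISPLAYED hypotheses on abstract members (neither is typed by the index —
p613168 ∕ p613383); nothing of Bałaban's refuted; whether the binders' letters EXIST at (1.5)-members is [4] Thm 3.1 ∕ N06 content, untouched.  Count-neutral; N05 NOT
discharged; no count claim (the chair's single count line is the only count); `T_η ↦ ℤᵈ`; one finite `𝕋⁴` programme at fixed `ε`, Bałaban AS PRINTED; the Yang–Mills mass gap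
(Clay) is NOT proved by any of this — R4 closes the conditional finite-`𝕋⁴` rung `BalabanLadder.UV` only; nothing continuum ∕ ℝ⁴ ∕ OS.  No `sorry`, no `def`, no `instance`,
no `notation`.  Unit `pub-ymgap-dag-n05-w2` (g3), 2026-08-28.

RELATED IN THE TREE, NOT DUPLICATED: `B8TowerBondsLayerLawSubC` ∕ `B8TowerBondsLayerLawOfLam` ∕ `B8TowerBondsLevelSep` (the (1.5)-reading faces — USED for the class-law corollary),
`B8IdxB8SubCLayerLawVacuity` ∕ `B8SockLettersRDIdxB8LawsBVacuity` (the two exhibits), `B8IdxB8LamTopTowerDisjoint` (dag-n05-c g15, p613464: the forward direction, USED for the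
iff and the A6), `B8Prop5LandauIdxLayer` (n05-c g5: `TowerDisjoint` on the Landau carrier), `B8Eq191FlatLettersCubeMember` (`under_smul_self`, `under_iff_blockMap_eq`, USED),
`B8Ineq166Univ` (`under_add_of_under`, USED), `B8CubeMemberZd` (`inBox_tower_iff_under`, USED), `B8Eq131DomainSeq` (r05: `isLevel_pow_smul`, USED).

[cite: Balaban1985RegularSpaces, (1.3)–(1.6) p.77, (1.131) p.99, p.98]
-/

noncomputable section

namespace Literature.MathematicalPhysics.QuantumFieldTheory.Balaban1983to89.B8IdxB8LamTopOfTowerDisjoint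

open Literature.MathematicalPhysics.QuantumLattice (blockMap)
open B7Prop1Explicit B7Prop1Local
open B8Ineq132 (Under)
open B8Ineq130 (tlo thi)
open B8LeafModelZd (ZdIdx)
open B8ConstraintBonds (DomainSeq Lam)
open B8Eq131DomainSeq (isLevel_pow_smul)
open B8Eq131CubesAdmissible (cubeFam)
open B8CubeMemberZd (inBox_tower_iff_under)
open B8Eq191FlatLettersCubeMember (under_smul_self under_iff_blockMap_eq)
open B8Ineq166Univ (under_add_of_under)
open B8TowerBondsPrinted (towerBondsP)
open B9Eq316AveragingTransposeZdPrinted (LevelSepPP)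
open B8IdxB8LawsB (IdxB8LawsB)
open B8TowerBondsLayerLawSubC (IdxB8SubC.levelSepPP_towerBondsP_of_lamTop exists_idxB8SubC_topCube_pinned)
open B8IdxB8LamTopTowerDisjoint (towers_disjoint_top_of_lamTop)
open Node00 (IdxB8Laws Stage3Params IdxB8SubC)

-- `Site` alone could resolve to the torus sites of `Setup.lean`; re-export the `ℤ^d` sites of `B7Prop1Explicit`.
export B7Prop1Explicit (Site)

/-- `1 ≤ θ.L` (Bałaban's block size is odd `> 1`; private plumbing). [folklore] -/
private theorem one_le_L (θ : Stage3Params) : 1 ≤ θ.L := le_trans (by norm_num) θ.two_le_L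

variable {d : ℕ}

/-! ## §1 Top-tower disjointness ⇒ the (1.5)-reading -/

section Converse

variable {L : ℕ}

/-- ★★ **TOP-TOWER DISJOINTNESS IMPLIES THE (1.5)-READING** on a member of n05-a's index obeying NODE 00's located laws (№11 `cover`) whose Ω-tower is a (1.3)–(1.4) domain
sequence (`sat`); `L ≥ 1`.  The disjointness hypothesis is dag-n05-c's text («two top towers sharing a fine site have the same level and the same top»).  For a top `z ∈ Λs k j`,
`j < k`, the corner `Lʲ•z` is a level-`j` point of `Ω_j` (`htower`) outside `Ω_{j+1}` (else `sat` + `cover` at level `j+1` put it under a second, higher top — see the module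
docstring), i.e. a point of `Λ_j = Ω_j^{(j)} ∖ Ω_{j+1}^{(j)}`. [cite: Balaban1985RegularSpaces, (1.5)–(1.6) p.77 («Λ_j = Ω_j^{(j)} ∖ Ω_{j+1}^{(j)}», «Ω_j^{(j)} = ⋃ B^{l−j}(Λ_l)»), (1.4) p.77] -/
theorem lamTop_of_towersDisjoint (hL : 1 ≤ L) (i : ZdIdx d L) (hlaws : IdxB8Laws L i) (hΩ : DomainSeq L i.Ω)
    (hdisj : ∀ j, j ≤ i.k → ∀ j', j' ≤ i.k → ∀ z ∈ i.Λs i.k j, ∀ z' ∈ i.Λs i.k j', ∀ x,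
      Under L j z x → Under L j' z' x → j = j' ∧ z = z') :
    ∀ j, j < i.k → ∀ z ∈ i.Λs i.k j, ((L : ℤ) ^ j) • z ∈ Lam L i.Ω j := by
  intro j hj z hz
  have hcz : Under L j z (((L : ℤ) ^ j) • z) := under_smul_self hL j z
  refine ⟨isLevel_pow_smul L j z, i.htower j hj.le z hz _ ((inBox_tower_iff_under L j z _).mpr hcz), fun hc => ?_⟩
  -- the `(j+1)`-block of the corner lies in `Ω_{j+1}` (`sat`), hence under a higher top (`cover`)
  have hwc : Under L (j + 1) (blockMap (L ^ (j + 1)) (((L : ℤ) ^ j) • z)) (((L : ℤ) ^ j) • z) :=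
    (under_iff_blockMap_eq hL (j + 1) _ _).mpr rfl
  have hblock : ∀ x, InBox (tlo L (blockMap (L ^ (j + 1)) (((L : ℤ) ^ j) • z)) (j + 1))
      (thi L (blockMap (L ^ (j + 1)) (((L : ℤ) ^ j) • z)) (j + 1)) x → x ∈ i.Ω (j + 1) := by
    intro x hx
    have h1 : blockMap (L ^ (j + 1)) x = blockMap (L ^ (j + 1)) (((L : ℤ) ^ j) • z) :=
      (under_iff_blockMap_eq hL (j + 1) _ x).mp ((inBox_tower_iff_under L (j + 1) _ x).mp hx)
    exact hΩ.sat (j + 1) _ x h1.symm hc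
  obtain ⟨j', hj1, hj'k, y, hy, hyw⟩ := hlaws.cover (j + 1) hj _ hblock
  have hyc : Under L j' y (((L : ℤ) ^ j) • z) := by
    have h := under_add_of_under hyw hwc
    rwa [Nat.sub_add_cancel hj1] at h
  obtain ⟨hjj, -⟩ := hdisj j hj.le j' hj'k z hz y hy _ hcz hyc
  omega

/-- ★★ **THE TWO REPAIR LETTERS ARE EQUIVALENT** on a member obeying `IdxB8Laws` with a (1.3)–(1.4) domain sequence (`L ≥ 1`): print's (1.5) corner reading `LamTop` ⟺
pairwise disjointness of the top towers — dag-n05-c's `towers_disjoint_top_of_lamTop` (p613464) and §1's converse. [cite: Balaban1985RegularSpaces, (1.5)–(1.6) p.77, (1.4) p.77] -/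
theorem lamTop_iff_towersDisjoint_top (hL : 1 ≤ L) (i : ZdIdx d L) (hlaws : IdxB8Laws L i) (hΩ : DomainSeq L i.Ω) :
    (∀ j, j < i.k → ∀ z ∈ i.Λs i.k j, ((L : ℤ) ^ j) • z ∈ Lam L i.Ω j) ↔
      ∀ j, j ≤ i.k → ∀ j', j' ≤ i.k → ∀ z ∈ i.Λs i.k j, ∀ z' ∈ i.Λs i.k j', ∀ x,
        Under L j z x → Under L j' z' x → j = j' ∧ z = z' :=
  ⟨towers_disjoint_top_of_lamTop hL i hlaws hΩ, lamTop_of_towersDisjoint hL i hlaws hΩ⟩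

variable {θ : Stage3Params}

/-- ★ **The equivalence on the admissible sub-index of record** `IdxB8SubC θ` (laws and `DomainSeq` by name). [cite: Balaban1985RegularSpaces, (1.5)–(1.6) p.77, (1.4) p.77] -/
theorem IdxB8SubC.lamTop_iff_towersDisjoint_top (j : IdxB8SubC θ) :
    (∀ l, l < j.1.1.1.k → ∀ z ∈ j.1.1.1.Λs j.1.1.1.k l, ((θ.L : ℤ) ^ l) • z ∈ Lam θ.L j.1.1.1.Ω l) ↔
      ∀ l, l ≤ j.1.1.1.k → ∀ l', l' ≤ j.1.1.1.k → ∀ z ∈ j.1.1.1.Λs j.1.1.1.k l, ∀ z' ∈ j.1.1.1.Λs j.1.1.1.k l', ∀ x,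
        Under θ.L l z x → Under θ.L l' z' x → l = l' ∧ z = z' :=
  B8IdxB8LamTopOfTowerDisjoint.lamTop_iff_towersDisjoint_top (one_le_L θ) j.1.1.1 j.1.2.toIdxB8Laws j.2

/-- ★ **The same on the admissible sub-index of record** `IdxB8SubC θ` (laws №11 and `DomainSeq.sat` supplied by the index, BY NAME): top-tower disjointness ⇒ `LamTop`.
[cite: Balaban1985RegularSpaces, (1.5)–(1.6) p.77, (1.4) p.77] -/
theorem IdxB8SubC.lamTop_of_towersDisjoint (j : IdxB8SubC θ)
    (hdisj : ∀ l, l ≤ j.1.1.1.k → ∀ l', l' ≤ j.1.1.1.k → ∀ z ∈ j.1.1.1.Λs j.1.1.1.k l, ∀ z' ∈ j.1.1.1.Λs j.1.1.1.k l', ∀ x,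
      Under θ.L l z x → Under θ.L l' z' x → l = l' ∧ z = z') :
    ∀ l, l < j.1.1.1.k → ∀ z ∈ j.1.1.1.Λs j.1.1.1.k l, ((θ.L : ℤ) ^ l) • z ∈ Lam θ.L j.1.1.1.Ω l :=
  B8IdxB8LamTopOfTowerDisjoint.lamTop_of_towersDisjoint (one_le_L θ) j.1.1.1 j.1.2.toIdxB8Laws j.2 hdisj

/-- **Hence the P-class law from top-tower disjointness** on `IdxB8SubC θ`, every truncation `m ≤ k` (p611723's `IdxB8SubC.levelSepPP_towerBondsP_of_lamTop` ∘ §1).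
[cite: Balaban1985RegularSpaces, (1.31) p.82, (1.3)–(1.6) p.77] -/
theorem IdxB8SubC.levelSepPP_towerBondsP_of_towersDisjoint (j : IdxB8SubC θ)
    (hdisj : ∀ l, l ≤ j.1.1.1.k → ∀ l', l' ≤ j.1.1.1.k → ∀ z ∈ j.1.1.1.Λs j.1.1.1.k l, ∀ z' ∈ j.1.1.1.Λs j.1.1.1.k l', ∀ x,
      Under θ.L l z x → Under θ.L l' z' x → l = l' ∧ z = z') :
    ∀ m, m ≤ j.1.1.1.k → LevelSepPP θ.L m j.1.1.1.Ω (fun m' l => towerBondsP θ.L j.1.1.1.Ω (j.1.1.1.Λs m') l) 1 :=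
  IdxB8SubC.levelSepPP_towerBondsP_of_lamTop j (IdxB8SubC.lamTop_of_towersDisjoint j hdisj)

end Converse

/-! ## §2 A6 at every depth: print's pinned tower has pairwise disjoint top towers (its (1.5)-reading ∘ the forward direction) -/

section Witness

/-- **A6 ON THE INDEX OF RECORD, EVERY DEPTH**: for every `θ` and `k ≥ 1`, print's pinned tower `(ℤᵈ, □₁, …, □_k)` (p611723 `exists_idxB8SubC_topCube_pinned`: a term of `IdxB8SubC θ`
reading (1.5)) has pairwise disjoint top towers (dag-n05-c's forward direction) — the hypothesis of §1 is inhabited on the «P₂C» index at every depth, so the equivalence is not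
between two empty predicates. [cite: Balaban1985RegularSpaces, (1.131) p.99, (1.5)–(1.6) p.77] -/
theorem exists_idxB8SubC_towersDisjoint (θ : Stage3Params) {k : ℕ} (hk : 1 ≤ k) :
    ∃ j : IdxB8SubC θ, j.1.1.1.k = k ∧ j.1.1.1.Ω = cubeFam true θ.L (0 : Site θ.D) 1 θ.L k ∧
      ∀ l, l ≤ j.1.1.1.k → ∀ l', l' ≤ j.1.1.1.k → ∀ z ∈ j.1.1.1.Λs j.1.1.1.k l, ∀ z' ∈ j.1.1.1.Λs j.1.1.1.k l', ∀ x,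
        Under θ.L l z x → Under θ.L l' z' x → l = l' ∧ z = z' := by
  obtain ⟨j, hjk, -, hΩ, -, hreads⟩ := exists_idxB8SubC_topCube_pinned θ hk
  exact ⟨j, hjk, hΩ, (IdxB8SubC.lamTop_iff_towersDisjoint_top j).mp fun l hl z hz => (hreads l hl z).mp hz⟩

end Witness

end Literature.MathematicalPhysics.QuantumFieldTheory.Balaban1983to89.B8IdxB8LamTopOfTowerDisjoint

end
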